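import Mathlib
import Summits.NavierStokesRegularity.NavierStokesRegularity.Theorems.FilamentSkeletonRssDefectColumnGateContinuity

/-!
# Route `FilamentSkeletonRss` · ∀-crux `TransverseReduction1AR` (stmt-NavierStokesRegularity-23611) · line `defect_column_gate_1AR` → «A1R-acc»:
# S3b ONE DIMENSION UP — continuity of a bordered functional at the frozen Picard fixed point, over an ABSTRACT parameter set

Helper file (theorems only), `--supports stmt-NavierStokesRegularity-23611 --as helper`; LEAD of 23611, lane ns-filament-21221-p1 g13.

`stub_defectContinuity1AG` (p646054, `…DefectColumnGateContinuity.lean`) proves: for a re-wound family and a defect gate in the contraction regime,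
the scalar defect coefficient `β ↦ 𝓫_β G_β` of the frozen-rate fixed points `G_β = −r_β − D(𝓚_β G_β)[𝓚_β G_β]` is continuous on the rate window.
The A1R-acc re-cut (director-ns dss_120 KEEP-R4 branch; LEAD memo `Cruxes/TransverseReductionRJ/Lines/defect_column_gate_1AL_accretion.md` §9; tenure
kit `DESIGN-A1Racc-exists-side-g26.md` §2–§3) needs the SAME statement with (i) the parameter `(p, β)` ranging over the core-area box times the rate
window and (ii) `N + 1` bordered functionals (`𝓫` and the accretion coefficients `𝓬_j`).  Both are instances of ONE abstract theorem, proved here by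
the p646054 argument with the parameter abstracted: a parameter set `S` in a pseudo-metric space, residuals `r_π` (`Y ≤ ε`) locally continuous in
`π` on balls, an operator family `𝓚_π` with the gate's bound (1) / linearity (2) / tightness (3) / local-continuity (4) clauses, and ONE scalar
functional `ℓ_π` with bound / linearity / tightness / local continuity:

* `picardIter_locClose_param` — the Picard iterates `P_π^n` (from `0`) are locally continuous in `π` on every ball (induction on `n`; a finite
  regress of balls through (3), (4) and the residual's local continuity);
* `continuousOn_functional_fixedPoint` — for ANY family of fixed points `G_π` in the `2ε`-ball (`16A²ε ≤ 1`), `π ↦ ℓ_π G_π` is `ContinuousOn S`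
  (four pieces: geometric tails `ℓ(G − Pⁿ)` at `π'` and `π`, tightness of `ℓ` on the iterate difference, local continuity of `ℓ` at the datum `P_π^n`).

Reused by name: `picardIter`, `picardIter_bound`, `fixedPoint_sub_picardIter`, `norm_clm_sub_apply_le` (p646054) and the Y/X-scale algebra of
`…KelvinGateClosingPicard`.  HONEST FRAMING: parametric fixed-point bookkeeping for a HYPOTHETICAL filament-type rotating-self-similar blow-up route
(MODEL rung, negative side); nothing here bears on Navier–Stokes regularity; no stub of a registered skeleton is closed by this file.
-/

set_option linter.dupNamespace false

noncomputable section

namespace Summit.NavierStokesRegularity.NavierStokesRegularity.Theorems.DefectColumnGate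

open scoped BigOperators Topology InnerProductSpace ContDiff
open Filter Set Function MeasureTheory Metric
open Literature.Analysis.FluidPDE
open Summit.NavierStokesRegularity.NavierStokesRegularity.Theorems.KelvinGate

section Param

variable {P : Type*} [PseudoMetricSpace P] {S : Set P}
  {r : P → EuclideanSpace ℝ (Fin 3) → EuclideanSpace ℝ (Fin 3)}
  {𝓚 : P → (EuclideanSpace ℝ (Fin 3) → EuclideanSpace ℝ (Fin 3)) → EuclideanSpace ℝ (Fin 3) → EuclideanSpace ℝ (Fin 3)}
  {A ε : ℝ}

/-- **Local continuity of the Picard iterates in the parameter.**  Under the gate's operator bound (1), linearity (2), tightness (3) (uniform in the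
parameter) and local continuity (4) for `𝓚`, a residual family `r_π` with `Y(r_π) ≤ ε` locally continuous in `π` on balls, and `16A²ε ≤ 1`, `0 ≤ A`:
for every `n`, every `π ∈ S`, every ball `‖y‖ ≤ L` and every `t > 0` there is `δ > 0` with `‖P_π'^n(y) − P_π^n(y)‖ ≤ t` on the ball for all
`π' ∈ S` with `dist π' π < δ`. -/
theorem picardIter_locClose_param
    (hK1 : ∀ π ∈ S, ∀ (F : EuclideanSpace ℝ (Fin 3) → EuclideanSpace ℝ (Fin 3)) (R : ℝ), YBound F R → XBound (𝓚 π F) (A * R))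
    (hK2 : ∀ π ∈ S, ∀ (F G : EuclideanSpace ℝ (Fin 3) → EuclideanSpace ℝ (Fin 3)) (s : ℝ), (∃ R, YBound F R) →
      (∃ R, YBound G R) → 𝓚 π (fun y => F y + s • G y) = fun y => 𝓚 π F y + s • 𝓚 π G y)
    (hK3 : ∀ R L t : ℝ, 0 < t → ∃ L' δ₀ : ℝ, 0 < δ₀ ∧ ∀ π ∈ S, ∀ F : EuclideanSpace ℝ (Fin 3) → EuclideanSpace ℝ (Fin 3),
      YBound F R → (∀ y, ‖y‖ ≤ L' → ‖F y‖ ≤ δ₀) → ∀ y, ‖y‖ ≤ L → ‖𝓚 π F y‖ ≤ t ∧ ‖fderiv ℝ (𝓚 π F) y‖ ≤ t)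
    (hK4 : ∀ π ∈ S, ∀ (F : EuclideanSpace ℝ (Fin 3) → EuclideanSpace ℝ (Fin 3)) (R L t : ℝ), YBound F R → 0 < t →
      ∃ δ > 0, ∀ π' ∈ S, dist π' π < δ → LocClose (𝓚 π' F) (𝓚 π F) L t)
    (hres : ∀ π ∈ S, YBound (r π) ε)
    (hrc : ∀ π ∈ S, ∀ L t : ℝ, 0 < t → ∃ δ > 0, ∀ π' ∈ S, dist π' π < δ → ∀ y, ‖y‖ ≤ L → ‖r π' y - r π y‖ ≤ t)
    (hA : 16 * A ^ 2 * ε ≤ 1) (hA0 : 0 ≤ A) :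
    ∀ n : ℕ, ∀ π ∈ S, ∀ L t : ℝ, 0 < t → ∃ δ > 0, ∀ π' ∈ S, dist π' π < δ →
      ∀ y, ‖y‖ ≤ L → ‖picardIter (𝓚 π') (r π') n y - picardIter (𝓚 π) (r π) n y‖ ≤ t := by
  -- the Picard iterates at each parameter stay in the `2ε`-ball
  have hPb : ∀ π ∈ S, ∀ n, YBound (picardIter (𝓚 π) (r π) n) (2 * ε) :=
    fun π hπ n => picardIter_bound (hK1 π hπ) (hK2 π hπ) (hres π hπ) hA n
  intro n
  induction n with
  | zero =>
    intro π _ L t ht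
    refine ⟨1, one_pos, fun π' _ _ y _ => ?_⟩
    simp only [picardIter_zero, sub_self, norm_zero]
    exact ht.le
  | succ n ih =>
    intro π hπ L t ht
    have hε0 : 0 ≤ ε := (hres π hπ).nonneg
    -- the radius of the gate's outputs on the `2ε`-ball
    have ha0 : 0 ≤ A * (2 * ε) := by positivity
    obtain ⟨a, ha, ha0'⟩ : ∃ a : ℝ, a = A * (2 * ε) ∧ 0 ≤ a := ⟨_, rfl, ha0⟩
    have he₄0 : 0 < t / (3 * (2 * a + 1)) := by positivity
    have hFY : YBound (picardIter (𝓚 π) (r π) n) (2 * ε) := hPb π hπ n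
    -- gate clause (4) at the datum `Pₙ(π)`, target `e₄` on the ball `L`
    obtain ⟨δ₄, hδ₄, h4⟩ := hK4 π hπ (picardIter (𝓚 π) (r π) n) _ L (t / (3 * (2 * a + 1))) hFY he₄0
    -- gate tightness (3) for differences (`Y ≤ 4ε`), target `e₄` on the ball `L`
    obtain ⟨L', δ₀, hδ₀, h3⟩ := hK3 (2 * ε + 2 * ε) L (t / (3 * (2 * a + 1))) he₄0
    -- induction hypothesis on the larger ball
    obtain ⟨δn, hδn, hn⟩ := ih π hπ L' δ₀ hδ₀
    -- the residual's local continuity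
    obtain ⟨δr, hδr, hrr⟩ := hrc π hπ L (t / 3) (by positivity)
    refine ⟨min δn (min δ₄ δr), lt_min hδn (lt_min hδ₄ hδr), fun π' hπ' hd y hy => ?_⟩
    have hd1 : dist π' π < δn := lt_of_lt_of_le hd (min_le_left _ _)
    have hd4 : dist π' π < δ₄ := lt_of_lt_of_le hd ((min_le_right _ _).trans (min_le_left _ _))
    have hdr : dist π' π < δr := lt_of_lt_of_le hd ((min_le_right _ _).trans (min_le_right _ _))
    have hF'Y : YBound (picardIter (𝓚 π') (r π') n) (2 * ε) := hPb π' hπ' n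
    -- the difference of the `n`-th iterates and its smallness on `L′`
    have hdY : YBound (fun z => picardIter (𝓚 π') (r π') n z - picardIter (𝓚 π) (r π) n z) (2 * ε + 2 * ε) := hF'Y.sub hFY
    have hdsmall : ∀ z, ‖z‖ ≤ L' → ‖picardIter (𝓚 π') (r π') n z - picardIter (𝓚 π) (r π) n z‖ ≤ δ₀ :=
      fun z hz => hn π' hπ' hd1 z hz
    have h3K := h3 π' hπ' _ hdY hdsmall
    have h4K := h4 π' hπ' hd4
    have hrr' : ‖r π' y - r π y‖ ≤ t / 3 := hrr π' hπ' hdr y hy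
    -- `𝓚_π′ Pₙ(π′) = 𝓚_π′ Pₙ(π) + 𝓚_π′ d`
    have hKsplit : 𝓚 π' (picardIter (𝓚 π') (r π') n) = fun z => 𝓚 π' (picardIter (𝓚 π) (r π) n) z +
        𝓚 π' (fun z => picardIter (𝓚 π') (r π') n z - picardIter (𝓚 π) (r π) n z) z := by
      have e : (fun z => picardIter (𝓚 π) (r π) n z + (1:ℝ) • (fun z => picardIter (𝓚 π') (r π') n z - picardIter (𝓚 π) (r π) n z) z) =
          picardIter (𝓚 π') (r π') n := by funext z; simp
      have h := hK2 π' hπ' (picardIter (𝓚 π) (r π) n) (fun z => picardIter (𝓚 π') (r π') n z - picardIter (𝓚 π) (r π) n z) 1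
        ⟨_, hFY⟩ ⟨_, hdY⟩
      rw [e] at h
      rw [h]; funext z; simp
    -- X-bounds and pointwise sizes
    have hXF : XBound (𝓚 π' (picardIter (𝓚 π) (r π) n)) a := by rw [ha]; exact hK1 π' hπ' _ _ hFY
    have hXFπ : XBound (𝓚 π (picardIter (𝓚 π) (r π) n)) a := by rw [ha]; exact hK1 π hπ _ _ hFY
    have hXF' : XBound (𝓚 π' (picardIter (𝓚 π') (r π') n)) a := by rw [ha]; exact hK1 π' hπ' _ _ hF'Y
    have hXd : XBound (𝓚 π' (fun z => picardIter (𝓚 π') (r π') n z - picardIter (𝓚 π) (r π) n z)) (A * (2 * ε + 2 * ε)) :=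
      hK1 π' hπ' _ _ hdY
    obtain ⟨hv1, hD1⟩ := hXF.norm_le' y
    obtain ⟨hv2, hD2⟩ := hXFπ.norm_le' y
    obtain ⟨hv3, hD3⟩ := hXF'.norm_le' y
    obtain ⟨hKd, hDKd⟩ := h3K y hy
    obtain ⟨h4v, h4D⟩ := h4K y hy
    -- the `(n+1)`-st difference
    rw [picardIter_succ, picardIter_succ]
    simp only
    have hDsplit : fderiv ℝ (𝓚 π' (picardIter (𝓚 π') (r π') n)) y = fderiv ℝ (𝓚 π' (picardIter (𝓚 π) (r π) n)) y +
        fderiv ℝ (𝓚 π' (fun z => picardIter (𝓚 π') (r π') n z - picardIter (𝓚 π) (r π) n z)) y := by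
      rw [hKsplit]
      exact fderiv_fun_add (hXF.1.differentiable (by norm_num) y) (hXd.1.differentiable (by norm_num) y)
    have hvsplit : 𝓚 π' (picardIter (𝓚 π') (r π') n) y = 𝓚 π' (picardIter (𝓚 π) (r π) n) y +
        𝓚 π' (fun z => picardIter (𝓚 π') (r π') n z - picardIter (𝓚 π) (r π) n z) y := by rw [hKsplit]
    -- the four pieces
    set K'F := 𝓚 π' (picardIter (𝓚 π) (r π) n) with hK'F
    set KF := 𝓚 π (picardIter (𝓚 π) (r π) n) with hKF
    set K'F' := 𝓚 π' (picardIter (𝓚 π') (r π') n) with hK'F'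
    set K'd := 𝓚 π' (fun z => picardIter (𝓚 π') (r π') n z - picardIter (𝓚 π) (r π) n z) with hK'd
    have eT : fderiv ℝ K'F' y (K'F' y) - fderiv ℝ KF y (KF y) =
        fderiv ℝ K'd y (K'F' y) + fderiv ℝ K'F y (K'd y) + (fderiv ℝ K'F y (K'F y) - fderiv ℝ KF y (K'F y)) +
          fderiv ℝ KF y (K'F y - KF y) := by
      rw [hDsplit, hvsplit]
      simp only [_root_.add_apply, map_add, map_sub]
      abel
    have hT1 : ‖fderiv ℝ K'd y (K'F' y)‖ ≤ t / (3 * (2 * a + 1)) * a :=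
      (ContinuousLinearMap.le_opNorm _ _).trans (mul_le_mul hDKd hv3 (norm_nonneg _) he₄0.le)
    have hT2 : ‖fderiv ℝ K'F y (K'd y)‖ ≤ a * (t / (3 * (2 * a + 1))) :=
      (ContinuousLinearMap.le_opNorm _ _).trans (mul_le_mul hD1 hKd (norm_nonneg _) ha0')
    have hT3 : ‖fderiv ℝ K'F y (K'F y) - fderiv ℝ KF y (K'F y)‖ ≤ t / (3 * (2 * a + 1)) * a :=
      (norm_clm_sub_apply_le _ _ _).trans (mul_le_mul h4D hv1 (norm_nonneg _) he₄0.le)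
    have hT4 : ‖fderiv ℝ KF y (K'F y - KF y)‖ ≤ a * (t / (3 * (2 * a + 1))) :=
      (ContinuousLinearMap.le_opNorm _ _).trans (mul_le_mul hD2 h4v (norm_nonneg _) ha0')
    have hsum : ‖fderiv ℝ K'F' y (K'F' y) - fderiv ℝ KF y (KF y)‖ ≤ 4 * a * (t / (3 * (2 * a + 1))) := by
      rw [eT]
      calc _ ≤ ‖fderiv ℝ K'd y (K'F' y) + fderiv ℝ K'F y (K'd y) + (fderiv ℝ K'F y (K'F y) - fderiv ℝ KF y (K'F y))‖ +
            ‖fderiv ℝ KF y (K'F y - KF y)‖ := norm_add_le _ _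
        _ ≤ (‖fderiv ℝ K'd y (K'F' y) + fderiv ℝ K'F y (K'd y)‖ + ‖fderiv ℝ K'F y (K'F y) - fderiv ℝ KF y (K'F y)‖) +
            ‖fderiv ℝ KF y (K'F y - KF y)‖ := by gcongr; exact norm_add_le _ _
        _ ≤ ((‖fderiv ℝ K'd y (K'F' y)‖ + ‖fderiv ℝ K'F y (K'd y)‖) + ‖fderiv ℝ K'F y (K'F y) - fderiv ℝ KF y (K'F y)‖) +
            ‖fderiv ℝ KF y (K'F y - KF y)‖ := by gcongr; exact norm_add_le _ _
        _ ≤ ((t / (3 * (2 * a + 1)) * a + a * (t / (3 * (2 * a + 1)))) + t / (3 * (2 * a + 1)) * a) + a * (t / (3 * (2 * a + 1))) := by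
            gcongr
        _ = 4 * a * (t / (3 * (2 * a + 1))) := by ring
    -- `4a·e₄ ≤ 2t/3`
    have hfrac : 4 * a * (t / (3 * (2 * a + 1))) ≤ 2 * t / 3 := by
      have hpos : 0 < 3 * (2 * a + 1) := by positivity
      rw [show 4 * a * (t / (3 * (2 * a + 1))) = (4 * a * t) / (3 * (2 * a + 1)) by ring, div_le_iff₀ hpos]
      nlinarith [ha0', ht.le]
    calc ‖-r π' y - fderiv ℝ K'F' y (K'F' y) - (-r π y - fderiv ℝ KF y (KF y))‖
        = ‖-(r π' y - r π y) - (fderiv ℝ K'F' y (K'F' y) - fderiv ℝ KF y (KF y))‖ := by congr 1; abel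
      _ ≤ ‖-(r π' y - r π y)‖ + ‖fderiv ℝ K'F' y (K'F' y) - fderiv ℝ KF y (KF y)‖ := norm_sub_le _ _
      _ ≤ t / 3 + 2 * t / 3 := by rw [norm_neg]; exact add_le_add hrr' (hsum.trans hfrac)
      _ = t := by ring

/-- **Continuity of a bordered functional at the frozen fixed point, over an abstract parameter set** (S3b one dimension up).  Same hypotheses on
`𝓚_π`, `r_π` as in `picardIter_locClose_param`; a scalar functional `ℓ_π` with the bound `|ℓ_π F| ≤ A·Y(F)`, linearity on Y-bounded data,
TIGHTNESS (`|ℓ_π F| ≤ t` once `F` with `Y(F) ≤ R` is `δ₀`-small on a ball `L'`, uniformly in `π ∈ S`) and LOCAL CONTINUITY in `π` at every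
Y-bounded datum.  Then for every family `G_π` (`π ∈ S`) of fixed points `G_π = −r_π − D(𝓚_π G_π)[𝓚_π G_π]` with `Y(G_π) ≤ 2ε`, the scalar
`π ↦ ℓ_π G_π` is continuous on `S`. -/
theorem continuousOn_functional_fixedPoint
    (hK1 : ∀ π ∈ S, ∀ (F : EuclideanSpace ℝ (Fin 3) → EuclideanSpace ℝ (Fin 3)) (R : ℝ), YBound F R → XBound (𝓚 π F) (A * R))
    (hK2 : ∀ π ∈ S, ∀ (F G : EuclideanSpace ℝ (Fin 3) → EuclideanSpace ℝ (Fin 3)) (s : ℝ), (∃ R, YBound F R) →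
      (∃ R, YBound G R) → 𝓚 π (fun y => F y + s • G y) = fun y => 𝓚 π F y + s • 𝓚 π G y)
    (hK3 : ∀ R L t : ℝ, 0 < t → ∃ L' δ₀ : ℝ, 0 < δ₀ ∧ ∀ π ∈ S, ∀ F : EuclideanSpace ℝ (Fin 3) → EuclideanSpace ℝ (Fin 3),
      YBound F R → (∀ y, ‖y‖ ≤ L' → ‖F y‖ ≤ δ₀) → ∀ y, ‖y‖ ≤ L → ‖𝓚 π F y‖ ≤ t ∧ ‖fderiv ℝ (𝓚 π F) y‖ ≤ t)
    (hK4 : ∀ π ∈ S, ∀ (F : EuclideanSpace ℝ (Fin 3) → EuclideanSpace ℝ (Fin 3)) (R L t : ℝ), YBound F R → 0 < t →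
      ∃ δ > 0, ∀ π' ∈ S, dist π' π < δ → LocClose (𝓚 π' F) (𝓚 π F) L t)
    (hres : ∀ π ∈ S, YBound (r π) ε)
    (hrc : ∀ π ∈ S, ∀ L t : ℝ, 0 < t → ∃ δ > 0, ∀ π' ∈ S, dist π' π < δ → ∀ y, ‖y‖ ≤ L → ‖r π' y - r π y‖ ≤ t)
    (hA : 16 * A ^ 2 * ε ≤ 1) (hA0 : 0 ≤ A)
    {ℓ : P → (EuclideanSpace ℝ (Fin 3) → EuclideanSpace ℝ (Fin 3)) → ℝ}
    (hℓ1 : ∀ π ∈ S, ∀ (F : EuclideanSpace ℝ (Fin 3) → EuclideanSpace ℝ (Fin 3)) (R : ℝ), YBound F R → |ℓ π F| ≤ A * R)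
    (hℓ2 : ∀ π ∈ S, ∀ (F G : EuclideanSpace ℝ (Fin 3) → EuclideanSpace ℝ (Fin 3)) (s : ℝ), (∃ R, YBound F R) →
      (∃ R, YBound G R) → ℓ π (fun y => F y + s • G y) = ℓ π F + s * ℓ π G)
    (hℓ3 : ∀ R t : ℝ, 0 < t → ∃ L' δ₀ : ℝ, 0 < δ₀ ∧ ∀ π ∈ S, ∀ F : EuclideanSpace ℝ (Fin 3) → EuclideanSpace ℝ (Fin 3),
      YBound F R → (∀ y, ‖y‖ ≤ L' → ‖F y‖ ≤ δ₀) → |ℓ π F| ≤ t)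
    (hℓ4 : ∀ π ∈ S, ∀ (F : EuclideanSpace ℝ (Fin 3) → EuclideanSpace ℝ (Fin 3)) (R t : ℝ), YBound F R → 0 < t →
      ∃ δ > 0, ∀ π' ∈ S, dist π' π < δ → |ℓ π' F - ℓ π F| ≤ t)
    {G : P → EuclideanSpace ℝ (Fin 3) → EuclideanSpace ℝ (Fin 3)}
    (hG : ∀ π ∈ S, YBound (G π) (2 * ε) ∧ ∀ y, G π y = -r π y - fderiv ℝ (𝓚 π (G π)) y (𝓚 π (G π) y)) :
    ContinuousOn (fun π => ℓ π (G π)) S := by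
  have hPb : ∀ π ∈ S, ∀ n, YBound (picardIter (𝓚 π) (r π) n) (2 * ε) :=
    fun π hπ n => picardIter_bound (hK1 π hπ) (hK2 π hπ) (hres π hπ) hA n
  have hdist : ∀ π ∈ S, ∀ n, YBound (fun y => G π y - picardIter (𝓚 π) (r π) n y) (2 * ε / 2 ^ n) :=
    fun π hπ n => fixedPoint_sub_picardIter (hK1 π hπ) (hK2 π hπ) (hres π hπ) hA (hG π hπ).1 (hG π hπ).2 n
  have hloc := picardIter_locClose_param hK1 hK2 hK3 hK4 hres hrc hA hA0
  -- `ℓ_π F − ℓ_π F′ = ℓ_π (F − F′)`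
  have hℓsub : ∀ π ∈ S, ∀ (F F' : EuclideanSpace ℝ (Fin 3) → EuclideanSpace ℝ (Fin 3)) (R R' : ℝ), YBound F R → YBound F' R' →
      ℓ π F - ℓ π F' = ℓ π (fun y => F y - F' y) := by
    intro π hπ F F' R R' hF hF'
    have hd : YBound (fun y => F y - F' y) (R + R') := hF.sub hF'
    have e : (fun y => F' y + (1:ℝ) • (fun z => F z - F' z) y) = F := by funext y; simp
    have h := hℓ2 π hπ F' (fun z => F z - F' z) 1 ⟨R', hF'⟩ ⟨R + R', hd⟩
    rw [e] at h
    rw [h]; ring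
  rw [Metric.continuousOn_iff]
  intro π hπ t ht
  have hε0 : 0 ≤ ε := (hres π hπ).nonneg
  -- choose the truncation `n`: `A · (2ε/2ⁿ) ≤ t/8`
  obtain ⟨n, hn⟩ : ∃ n : ℕ, 16 * A * ε / t < (2:ℝ) ^ n := pow_unbounded_of_one_lt _ one_lt_two
  have hpow : (0:ℝ) < 2 ^ n := by positivity
  have htail : A * (2 * ε / 2 ^ n) ≤ t / 8 := by
    have h1 : 16 * A * ε < t * 2 ^ n := by
      have := (div_lt_iff₀ ht).mp hn; linarith
    rw [show A * (2 * ε / 2 ^ n) = (2 * A * ε) / 2 ^ n by ring, div_le_iff₀ hpow]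
    linarith
  -- tightness of `ℓ` for the difference of the `n`-th iterates, target `t/8`
  obtain ⟨L', δ₀, hδ₀, h3⟩ := hℓ3 (2 * ε + 2 * ε) (t / 8) (by positivity)
  obtain ⟨δn, hδn, hnloc⟩ := hloc n π hπ L' δ₀ hδ₀
  -- local continuity of `ℓ` at the datum `Pₙ(π)`, target `t/8`
  obtain ⟨δ₄, hδ₄, h4⟩ := hℓ4 π hπ (picardIter (𝓚 π) (r π) n) _ (t / 8) (hPb π hπ n) (by positivity)
  refine ⟨min δn δ₄, lt_min hδn hδ₄, fun π' hπ' hd => ?_⟩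
  rw [Real.dist_eq]
  have hd1 : dist π' π < δn := lt_of_lt_of_le hd (min_le_left _ _)
  have hd4 : dist π' π < δ₄ := lt_of_lt_of_le hd (min_le_right _ _)
  -- the four pieces
  have p1 : |ℓ π' (G π') - ℓ π' (picardIter (𝓚 π') (r π') n)| ≤ t / 8 := by
    rw [hℓsub π' hπ' _ _ _ _ (hG π' hπ').1 (hPb π' hπ' n)]
    exact (hℓ1 π' hπ' _ _ (hdist π' hπ' n)).trans htail
  have p4 : |ℓ π (picardIter (𝓚 π) (r π) n) - ℓ π (G π)| ≤ t / 8 := by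
    rw [abs_sub_comm, hℓsub π hπ _ _ _ _ (hG π hπ).1 (hPb π hπ n)]
    exact (hℓ1 π hπ _ _ (hdist π hπ n)).trans htail
  have p2 : |ℓ π' (picardIter (𝓚 π') (r π') n) - ℓ π' (picardIter (𝓚 π) (r π) n)| ≤ t / 8 := by
    rw [hℓsub π' hπ' _ _ _ _ (hPb π' hπ' n) (hPb π hπ n)]
    exact h3 π' hπ' _ ((hPb π' hπ' n).sub (hPb π hπ n)) (fun z hz => hnloc π' hπ' hd1 z hz)
  have p3 : |ℓ π' (picardIter (𝓚 π) (r π) n) - ℓ π (picardIter (𝓚 π) (r π) n)| ≤ t / 8 := h4 π' hπ' hd4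
  calc |ℓ π' (G π') - ℓ π (G π)|
      = |(ℓ π' (G π') - ℓ π' (picardIter (𝓚 π') (r π') n)) + (ℓ π' (picardIter (𝓚 π') (r π') n) - ℓ π' (picardIter (𝓚 π) (r π) n)) +
          (ℓ π' (picardIter (𝓚 π) (r π) n) - ℓ π (picardIter (𝓚 π) (r π) n)) + (ℓ π (picardIter (𝓚 π) (r π) n) - ℓ π (G π))| := by
        congr 1; ring
    _ ≤ |ℓ π' (G π') - ℓ π' (picardIter (𝓚 π') (r π') n)| + |ℓ π' (picardIter (𝓚 π') (r π') n) - ℓ π' (picardIter (𝓚 π) (r π) n)| +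
          |ℓ π' (picardIter (𝓚 π) (r π) n) - ℓ π (picardIter (𝓚 π) (r π) n)| + |ℓ π (picardIter (𝓚 π) (r π) n) - ℓ π (G π)| := by
        refine (abs_add_le _ _).trans ?_
        refine add_le_add ((abs_add_le _ _).trans (add_le_add (abs_add_le _ _) le_rfl)) le_rfl
    _ ≤ t / 8 + t / 8 + t / 8 + t / 8 := by gcongr
    _ < t := by linarith

/-- **The fixed-point field itself is locally continuous in the parameter** (on balls, values): `‖G_π'(y) − G_π(y)‖ ≤ t` on `‖y‖ ≤ L` for `π'`
near `π` — from the geometric tails and the local continuity of the iterates.  (Used by S3-acc to certify the ∃-side's continuity requests on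
the selected profile, if any.) -/
theorem fixedPoint_locClose_param
    (hK1 : ∀ π ∈ S, ∀ (F : EuclideanSpace ℝ (Fin 3) → EuclideanSpace ℝ (Fin 3)) (R : ℝ), YBound F R → XBound (𝓚 π F) (A * R))
    (hK2 : ∀ π ∈ S, ∀ (F G : EuclideanSpace ℝ (Fin 3) → EuclideanSpace ℝ (Fin 3)) (s : ℝ), (∃ R, YBound F R) →
      (∃ R, YBound G R) → 𝓚 π (fun y => F y + s • G y) = fun y => 𝓚 π F y + s • 𝓚 π G y)
    (hK3 : ∀ R L t : ℝ, 0 < t → ∃ L' δ₀ : ℝ, 0 < δ₀ ∧ ∀ π ∈ S, ∀ F : EuclideanSpace ℝ (Fin 3) → EuclideanSpace ℝ (Fin 3),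
      YBound F R → (∀ y, ‖y‖ ≤ L' → ‖F y‖ ≤ δ₀) → ∀ y, ‖y‖ ≤ L → ‖𝓚 π F y‖ ≤ t ∧ ‖fderiv ℝ (𝓚 π F) y‖ ≤ t)
    (hK4 : ∀ π ∈ S, ∀ (F : EuclideanSpace ℝ (Fin 3) → EuclideanSpace ℝ (Fin 3)) (R L t : ℝ), YBound F R → 0 < t →
      ∃ δ > 0, ∀ π' ∈ S, dist π' π < δ → LocClose (𝓚 π' F) (𝓚 π F) L t)
    (hres : ∀ π ∈ S, YBound (r π) ε)
    (hrc : ∀ π ∈ S, ∀ L t : ℝ, 0 < t → ∃ δ > 0, ∀ π' ∈ S, dist π' π < δ → ∀ y, ‖y‖ ≤ L → ‖r π' y - r π y‖ ≤ t)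
    (hA : 16 * A ^ 2 * ε ≤ 1) (hA0 : 0 ≤ A)
    {G : P → EuclideanSpace ℝ (Fin 3) → EuclideanSpace ℝ (Fin 3)}
    (hG : ∀ π ∈ S, YBound (G π) (2 * ε) ∧ ∀ y, G π y = -r π y - fderiv ℝ (𝓚 π (G π)) y (𝓚 π (G π) y)) :
    ∀ π ∈ S, ∀ L t : ℝ, 0 < t → ∃ δ > 0, ∀ π' ∈ S, dist π' π < δ → ∀ y, ‖y‖ ≤ L → ‖G π' y - G π y‖ ≤ t := by
  have hdist : ∀ π ∈ S, ∀ n, YBound (fun y => G π y - picardIter (𝓚 π) (r π) n y) (2 * ε / 2 ^ n) :=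
    fun π hπ n => fixedPoint_sub_picardIter (hK1 π hπ) (hK2 π hπ) (hres π hπ) hA (hG π hπ).1 (hG π hπ).2 n
  have hloc := picardIter_locClose_param hK1 hK2 hK3 hK4 hres hrc hA hA0
  intro π hπ L t ht
  have hε0 : 0 ≤ ε := (hres π hπ).nonneg
  obtain ⟨n, hn⟩ : ∃ n : ℕ, 8 * ε / t < (2:ℝ) ^ n := pow_unbounded_of_one_lt _ one_lt_two
  have hpow : (0:ℝ) < 2 ^ n := by positivity
  have htail : 2 * ε / 2 ^ n ≤ t / 4 := by
    have h1 : 8 * ε < t * 2 ^ n := by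
      have := (div_lt_iff₀ ht).mp hn; linarith
    rw [div_le_iff₀ hpow]
    linarith
  obtain ⟨δn, hδn, hnloc⟩ := hloc n π hπ L (t / 2) (by positivity)
  refine ⟨δn, hδn, fun π' hπ' hd y hy => ?_⟩
  have q1 : ‖G π' y - picardIter (𝓚 π') (r π') n y‖ ≤ t / 4 := ((hdist π' hπ' n).norm_le' y).1.trans htail
  have q3 : ‖G π y - picardIter (𝓚 π) (r π) n y‖ ≤ t / 4 := ((hdist π hπ n).norm_le' y).1.trans htail
  have q2 : ‖picardIter (𝓚 π') (r π') n y - picardIter (𝓚 π) (r π) n y‖ ≤ t / 2 := hnloc π' hπ' hd y hy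
  calc ‖G π' y - G π y‖ = ‖(G π' y - picardIter (𝓚 π') (r π') n y) + (picardIter (𝓚 π') (r π') n y - picardIter (𝓚 π) (r π) n y) -
        (G π y - picardIter (𝓚 π) (r π) n y)‖ := by congr 1; abel
    _ ≤ ‖(G π' y - picardIter (𝓚 π') (r π') n y) + (picardIter (𝓚 π') (r π') n y - picardIter (𝓚 π) (r π) n y)‖ +
        ‖G π y - picardIter (𝓚 π) (r π) n y‖ := norm_sub_le _ _
    _ ≤ ‖G π' y - picardIter (𝓚 π') (r π') n y‖ + ‖picardIter (𝓚 π') (r π') n y - picardIter (𝓚 π) (r π) n y‖ +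
        ‖G π y - picardIter (𝓚 π) (r π) n y‖ := by gcongr; exact norm_add_le _ _
    _ ≤ t / 4 + t / 2 + t / 4 := by gcongr
    _ = t := by ring

end Param

end Summit.NavierStokesRegularity.NavierStokesRegularity.Theorems.DefectColumnGate

end
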